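import Summits.AtomisticToContinuum.Crystallization.Theorems.LayeredLawsSelectHcp.Negative.DiracLaws

/-!
# Negative knowledge for crux `LayeredLawsSelectHcp` (stmt-AtomisticToContinuum-9226), VI:
# mutation — the root clause of H1 follows from the Mecke identity H2

Part VI (`--supports stmt-AtomisticToContinuum-9226`). **`ae_zero_mem_of_pointStationary`**: if `P`
satisfies the crux's point-stationarity H2 and is a.s. the counting measure of a countable set, then
`P`-a.s. the sample charges the origin (or is the zero measure) — mass transport with
`g(ν, y) = 1[ν{0} = 0]`: `E[μ(ℝ³); μ{0} = 0] = E[#{y ∈ μ : (θ_{-y}μ){0} = 0}] = E[#{y ∈ μ : μ{y} = 0}] = 0`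
(`map_sub_apply_singleton_zero`). So the `0 ∈ S` clause of H1 is not load-bearing, and since `δ` occurs
only in H1 while H4's shells separate points, H1 is decoration: the crux at any fixed small `δ` is the
general case. All `[folklore]`.
-/

noncomputable section

namespace Summit.AtomisticToContinuum.Crystallization.Theorems.LayeredLawsSelectHcp.Negative.RootClause

open MeasureTheory Set
open Literature.MathematicalPhysics.StatisticalMechanics Literature.Geometry.DiscreteGeometry
open Summit.AtomisticToContinuum.Crystallization.Theses.PalmUnimodularRigidity (LayeredLawsSelectHcp)
open Summit.AtomisticToContinuum.Crystallization.Theorems.ChargedEnergyGapNegative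
  (eStar eStar_le bddBelow_energyPerParticle_lennardJones)

/-- Euclidean `3`-space. [folklore] -/
local notation "E3" => EuclideanSpace ℝ (Fin 3)
open Summit.AtomisticToContinuum.Crystallization.Theorems.LayeredLawsSelectHcp.Negative.DiracLaws

/-! ## §9 Mutation: the root clause of H1 follows from H2 (Mecke with `g = 1[ν{0} = 0]`) -/

/-- Shifting a measure by `−y` moves the mass of `{y}` to the origin. [folklore] -/
theorem map_sub_apply_singleton_zero (μ : Measure E3) (y : E3) :
    Measure.map (fun z => z - y) μ {0} = μ {y} := by
  rw [Measure.map_apply (measurable_sub_const y) (measurableSet_singleton 0)]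
  congr 1
  ext z
  simp [sub_eq_zero]

/-- **H1's root clause is not load-bearing given H2**: under the Mecke identity, a law that is a.s.
the counting measure of a countable set a.s. CHARGES THE ORIGIN or vanishes — mass transport with
`g(ν, y) = 1[ν{0} = 0]`: `E[μ(ℝ³); μ{0} = 0] = E[#{y ∈ μ : μ{y} = 0}] = 0`. (With H4's shells giving
separation, H1 is decoration up to the value of `δ`, which occurs nowhere else in the crux.) [folklore] -/
theorem ae_zero_mem_of_pointStationary {P : Measure (Measure E3)} (h2 : PointStationary P)
    (hc : ∀ᵐ μ ∂P, ∃ S : Set E3, S.Countable ∧ μ = (Measure.count : Measure E3).restrict S) :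
    ∀ᵐ μ ∂P, μ = 0 ∨ μ {0} ≠ 0 := by
  have hA : MeasurableSet {ν : Measure E3 | ν {0} = 0} :=
    Measure.measurable_coe (measurableSet_singleton 0) (measurableSet_singleton 0)
  set g : Measure E3 → E3 → ENNReal := fun ν _ => if ν {0} = 0 then 1 else 0 with hg
  have hmeas : Measurable (Function.uncurry g) := by
    refine Measurable.ite ?_ measurable_const measurable_const
    exact measurable_fst hA
  have key := h2 g hmeas
  -- the right-hand side vanishes: at a point `y` of `μ = count|S`, `(θ_{-y} μ){0} = μ{y} = 1`
  have hR : ∫⁻ μ, ∫⁻ y, g (Measure.map (fun z => z - y) μ) (-y) ∂μ ∂P = 0 := by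
    have hae : ∀ᵐ μ ∂P, ∫⁻ y, g (Measure.map (fun z => z - y) μ) (-y) ∂μ = 0 := by
      filter_upwards [hc] with μ ⟨S, hS, hμ⟩
      have hin : ∀ᵐ y ∂μ, g (Measure.map (fun z => z - y) μ) (-y) = 0 := by
        rw [hμ]
        filter_upwards [ae_restrict_mem hS.measurableSet] with y hy
        simp only [hg, map_sub_apply_singleton_zero, count_restrict_singleton hy, one_ne_zero,
          if_false]
      rw [lintegral_congr_ae hin, lintegral_zero]
    rw [lintegral_congr_ae hae, lintegral_zero]
  -- the left-hand side is `E[μ(ℝ³); μ{0} = 0]`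
  have hL : ∫⁻ μ, ∫⁻ y, g μ y ∂μ ∂P = ∫⁻ μ, (if μ {0} = 0 then 1 else 0) * μ Set.univ ∂P := by
    refine lintegral_congr fun μ => ?_
    simp only [hg, lintegral_const]
  rw [hL, hR] at key
  have hF : Measurable fun μ : Measure E3 => (if μ {0} = 0 then (1 : ENNReal) else 0) * μ Set.univ :=
    (Measurable.ite hA measurable_const measurable_const).mul (Measure.measurable_coe MeasurableSet.univ)
  have hae := (lintegral_eq_zero_iff hF).1 key
  filter_upwards [hae] with μ hμ
  simp only [Pi.zero_apply, mul_eq_zero, ite_eq_right_iff, one_ne_zero, imp_false,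
    Measure.measure_univ_eq_zero] at hμ
  tauto

end Summit.AtomisticToContinuum.Crystallization.Theorems.LayeredLawsSelectHcp.Negative.RootClause

end
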